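import Summits.QuantumFields.YangMills.Theorems.BalabanUVNodesN15NeumannCubeLiftDivergence
import Summits.QuantumFields.YangMills.Theorems.BalabanUVNodesN15NeumannCubeRightEntries
import HarnessLib

/-!
# Route «BalabanUVNodes» (K3⁷), node N15 = NE2, -a lane, PROGRAMME P file P-IIk: THE FORWARD RIGHT ENTRY `G^{↑}(□)∘∇_μ` THROUGH THE LIFT — identity and rows at both spacings on the torus
# of record (the record twin of N-IIn §3, by P-IIj's `∇*`-lift and N-IIn's source shift)

Cell `pub-ymgap`, seat `pub-ymgap-dag-n15-a` (KNIT-BY-NAME, g22; HUMAN RULING D-0062; chair R424 venue; `bears_on: R4∕N15`); `--kind proof --supports stmt-QuantumFields-20544 --as helper`.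
Sequel of P-IIj `…NeumannCubeLiftDivergence` (`chiCube_liftCubeG_comp_divAdj_mulOp`, `hasMaj_transplant_gDivAdj_pair`) and N-IIn `…NeumannCubeRightEntries` (`symbOp_sD_eq_neg_divAdj_comp_sT`,
`hasMaj_comp_fshift`).  CONSUMER: the record-torus edition of dag-n15-c's FILE 49 cut remainder `R̃ = Σ_k M_{h_k}G_k^{↑}[Δ_a, M_{h_k}]` (its `G_k^{↑}∘∇_μ` pieces).

WHAT.  Big torus `M`, cube torus `M′ ∣ M` (`M′_ν = 2S`), spacing `n`, cube `□ + c`, window `W`, chart `e`; `Y′_ν = Sym′∘(G′∘∇*′_ν)∘M_{χ_{□′}}` on the cube torus: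
* §1 `symbOp_sT_comp_mulOp` (`S_κ∘M_g = M_{g(·+e_κ)}∘S_κ`), ★★ `chiCube_liftCubeG_comp_sD_mulOp` — for `g` supported, with its `−e_μ`-translates, in the window:
  `χ_□∘G^{↑}∘ρ(sD_μ n)∘M_g = −((transplant W e Y′_μ ∘ M_{g(·+e_μ)}) ∘ S_μ)` (N-IIn `∇_μ = −∇*_μ∘S_μ`, then P-IIj's sandwiched `∇*`-lift);
* §2 ★★ `hasMaj_chiCube_liftCubeG_sD_mulOp_pair` — the rows `χ_□∘G^{↑}∘∇_μ∘M_g ≤ 1_□1_□·2βe^{δ}·e^{−δd}` at BOTH spacings (`|g| ≤ 1`), uniform in the volume: P-IIj's transplant rows, the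
  multiplier (cost `1`), N-IIn's source shift (cost `2e^{δ}`), the cube indicators re-harvested from `χ_□` on the left and `supp g ⊂ W` on the right.
The forward entry's two-grid DEFECT on the record torus is, like N-IIn's (c)⁺, conditional on the source-regularity letter `hSrc` (N-IIo); not typed here.
HONEST FRAMING.  Lattice algebra + block-majorant bookkeeping over LANDED rows ((1.110) letters via `ineq110_114_pair`); no new analytic estimate; `U ≡ 1` torus MODEL of [B5] §1 (cube tori
`2L^s` lifted to the torus of record by programme P); nothing of [B6] (2.38)–(2.40)∕[B9] asserted; N15 NOT discharged (object-bound; NE2⁺ NOT PRINTED); counts UNMOVED (typed 28∕28 ·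
discharged 5∕27); one finite torus pair per index — NOT continuum ∕ ℝ⁴ ∕ OS ∕ mass gap ∕ Clay.  Theorems only (0 `def`).
-/

noncomputable section

open scoped BigOperators Matrix
open Finset

namespace Summit.QuantumFields.YangMills.BalabanUVNodes.N15.TwoGrid

open Literature.MathematicalPhysics.QuantumFieldTheory.Balaban1983to89
open Literature.MathematicalPhysics.QuantumFieldTheory.Balaban1983to89.B5Prop11Plancherel (Tor fine unitVec)
open Literature.MathematicalPhysics.QuantumFieldTheory.Balaban1983to89.B6Prop26Gluing (mulOp mulOp_apply ind ind_nonneg ind_le_one)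
open Literature.MathematicalPhysics.QuantumFieldTheory.Balaban1983to89.B6Prop26ReachTransplant (restrictOp extendOp transplant)
open Literature.MathematicalPhysics.QuantumFieldTheory.King1986.Torus (blockOf tdistT tdistT_nonneg)
open Literature.MathematicalPhysics.QuantumFieldTheory.Balaban1983to89.B11SectG (BlockNorm HasMaj)
open Literature.MathematicalPhysics.QuantumFieldTheory.Balaban1983to89.B6UnitTorusCarrier (unitTorusGeo)
open Literature.MathematicalPhysics.QuantumFieldTheory.Balaban1983to89.B5SiteBridgeP12 (MP)
open Summit.QuantumFields.YangMills.BalabanUVNodes.N15.VectorPiece (kingPrV blkFine)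
open Summit.QuantumFields.YangMills.BalabanUVNodes.N15.Gluing (mulOp_comp_mulOp_of_support)

variable {d : ℕ}

/-! ## §1 The forward difference through the lift, behind a multiplier one step inside -/

section Algebra

variable (n : ℕ) [NeZero n] {M M' : Fin (d + 1) → ℕ} [∀ μ, NeZero (M μ)] [∀ μ, NeZero (M' μ)] (hM : ∀ μ, M' μ ∣ M μ) (c : Tor M) (S : ℕ)

omit [NeZero n] [∀ μ, NeZero (M μ)] in
/-- `S_κ ∘ M_g = M_{g(· + e_κ)} ∘ S_κ`: a source multiplier moves through the unit shift. [folklore] -/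
theorem symbOp_sT_comp_mulOp (κ : Fin (d + 1)) (g : Tor (fine n M) × Fin (d + 1) → ℝ) :
    symbOp M n (sT M n κ) ∘ₗ mulOp g = mulOp (fun b : Tor (fine n M) × Fin (d + 1) => g (b.1 + unitVec (fine n M) κ, b.2)) ∘ₗ symbOp M n (sT M n κ) := by
  refine LinearMap.ext fun f => funext fun b => ?_
  simp only [LinearMap.comp_apply, symbOp_sT_apply, mulOp_apply]

/-- ★★ **THE FORWARD DIFFERENCE THROUGH THE LIFT**: for a multiplier `g` supported, with its `−e_μ`-translates, in the window (`M′_ν = 2S`, `n ≥ 1`, `a > 0`):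
`χ_□ ∘ G^{↑}(□) ∘ ρ(sD_μ n) ∘ M_g = −((transplant W e (Sym′∘(G′∘∇*′_μ)∘M_{χ_{□′}}) ∘ M_{g(·+e_μ)}) ∘ S_μ)` — `∇_μ = −∇*_μ∘S_μ` (N-IIn), the shifted multiplier sits one step inside with its
`+e_μ`-translates, and P-IIj's sandwiched `∇*`-lift applies. [folklore] -/
theorem chiCube_liftCubeG_comp_sD_mulOp (hM2 : ∀ ν, M' ν = 2 * S) (hn : 1 ≤ n) {a : ℝ} (ha : 0 < a) (ν : Fin (d + 1)) {g : Tor (fine n M) × Fin (d + 1) → ℝ}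
    (hg : ∀ b, g b ≠ 0 → b ∈ cubeW n c S ∧ (b.1 - unitVec (fine n M) ν, b.2) ∈ cubeW n c S) :
    mulOp (chiCube M n c S) ∘ₗ liftCubeG n hM c S a ∘ₗ symbOp M n (sD M n ν (n : ℝ)) ∘ₗ mulOp g =
      -((transplant (cubeW n c S) (redBond n hM)
          (symOp M' n (torRed hM c) ∘ₗ (gOp M' n a ∘ₗ symbOp M' n ((n : ℝ) • (sTinv M' n ν - 1))) ∘ₗ mulOp (chiCube M' n (torRed hM c) S)) ∘ₗ
          mulOp (fun b : Tor (fine n M) × Fin (d + 1) => g (b.1 + unitVec (fine n M) ν, b.2))) ∘ₗ symbOp M n (sT M n ν)) := by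
  have hg' : ∀ b : Tor (fine n M) × Fin (d + 1), (fun b : Tor (fine n M) × Fin (d + 1) => g (b.1 + unitVec (fine n M) ν, b.2)) b ≠ 0 →
      b ∈ cubeW n c S ∧ (b.1 + unitVec (fine n M) ν, b.2) ∈ cubeW n c S := fun b hb => by
    obtain ⟨h1, h2⟩ := hg _ hb
    dsimp only at h2
    rw [add_sub_cancel_right] at h2
    exact ⟨h2, h1⟩
  rw [← chiCube_liftCubeG_comp_divAdj_mulOp n hM c S hM2 hn ha ν hg', symbOp_sD_eq_neg_divAdj_comp_sT, LinearMap.neg_comp, LinearMap.comp_neg, LinearMap.comp_neg]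
  simp only [LinearMap.comp_assoc]
  rw [symbOp_sT_comp_mulOp]

end Algebra

/-! ## §2 The rows at both spacings on the torus of record -/

section Rows

variable {L : ℕ} [NeZero L]

omit [NeZero L] in
/-- from a letter without indicators on `Z`, the two-sided cut letter of `χ_□ ∘ Z ∘ M_g` when `supp g` lies in the window. [folklore] -/
theorem hasMaj_chiCube_comp_mulOp_of {M : Fin (d + 1) → ℕ} [∀ μ, NeZero (M μ)] {k n : ℕ} [NeZero n] {c : Tor M} {S : ℕ}
    {Z : Module.End ℝ (Tor (fine n M) × Fin (d + 1) → ℝ)} {g : Tor (fine n M) × Fin (d + 1) → ℝ} (hg : ∀ b, g b ≠ 0 → b ∈ cubeW n c S) {B δ : ℝ} (hB : 0 ≤ B)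
    (h : HasMaj (BlockNorm.ofBlocks (unitTorusGeo L k M) (fun i : Tor (fine n M) × Fin (d + 1) => blockOf n M i.1))
      (BlockNorm.ofBlocks (unitTorusGeo L k M) (fun i : Tor (fine n M) × Fin (d + 1) => blockOf n M i.1))
      (mulOp (chiCube M n c S) ∘ₗ Z ∘ₗ mulOp g) (fun y y' => B * Real.exp (-(δ * tdistT M y y')))) :
    HasMaj (BlockNorm.ofBlocks (unitTorusGeo L k M) (fun i : Tor (fine n M) × Fin (d + 1) => blockOf n M i.1))
      (BlockNorm.ofBlocks (unitTorusGeo L k M) (fun i : Tor (fine n M) × Fin (d + 1) => blockOf n M i.1))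
      (mulOp (chiCube M n c S) ∘ₗ Z ∘ₗ mulOp g)
      (fun y y' => ind (cubeBlocks M c S : Set (Tor M)) y * ind (cubeBlocks M c S : Set (Tor M)) y' * (B * Real.exp (-(δ * tdistT M y y')))) := by
  -- `χ_□ ∘ (χ_□ ∘ Z ∘ M_g) ∘ M_{χ_□} = χ_□ ∘ Z ∘ M_g`
  have hχχ : mulOp (chiCube M n c S) ∘ₗ mulOp (chiCube M n c S) = mulOp (chiCube M n c S) :=
    mulOp_comp_mulOp_of_support fun b hb => by
      rw [chiCube_eq_ite] at hb ⊢
      by_cases h : b ∈ cubeW n c S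
      · rw [if_pos h]
      · rw [if_neg h] at hb; exact absurd rfl hb
  have hgχ : mulOp g ∘ₗ mulOp (chiCube M n c S) = mulOp g :=
    mulOp_comp_mulOp_of_support fun b hb => by rw [chiCube_eq_ite, if_pos (hg b hb)]
  have h1 := hasMaj_mulOp_chiCube_comp (c := c) (S := S) (fun _ _ => mul_nonneg hB (Real.exp_nonneg _)) h
  have h2 := hasMaj_comp_mulOp_chiCube (c := c) (S := S) (fun y y' => mul_nonneg (ind_nonneg _ _) (mul_nonneg hB (Real.exp_nonneg _))) h1
  have e : (mulOp (chiCube M n c S) ∘ₗ (mulOp (chiCube M n c S) ∘ₗ Z ∘ₗ mulOp g)) ∘ₗ mulOp (chiCube M n c S) = mulOp (chiCube M n c S) ∘ₗ Z ∘ₗ mulOp g := by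
    rw [← LinearMap.comp_assoc, hχχ]
    simp only [LinearMap.comp_assoc]
    rw [hgχ]
  exact (h2.congr fun f => by rw [e]).mono fun y y' => le_of_eq (by ring)

/-- ★★ **THE ROWS OF THE LIFTED FORWARD RIGHT ENTRY ON THE TORUS OF RECORD, BOTH SPACINGS**: for a source multiplier `|g| ≤ 1` supported, with its `−e_ν`-translates, in the window of the cube,
`χ_□ ∘ G^{↑}(□) ∘ ρ(sD_ν n) ∘ M_g ≤ 1_□1_□·2βe^{δ}·e^{−δ|y−y′|_T}` at the coarse spacing AND (primed) at the fine spacing, uniform in the volume — §1's identity, P-IIj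
`hasMaj_transplant_gDivAdj_pair`, the multiplier (cost `1`), N-IIn `hasMaj_comp_fshift` (cost `2e^{δ}`), the indicators re-harvested. [cite: Balaban1984PropagatorsII, (2.133)–(2.134) p.247 (shapes),
p.238 (T_□); Balaban1984PropagatorsI, Prop. 1.2 (1.110) p.35, (1.3) p.18] -/
theorem hasMaj_chiCube_liftCubeG_sD_mulOp_pair (hL : Odd L ∧ 1 < L) {a : ℝ} (ha : 0 < a) :
    ∃ δ β : ℝ, 0 < δ ∧ 0 < β ∧ ∀ (s mT k r : ℕ) (hs : s ≤ mT) (hk : 1 ≤ k) (c : Tor (MP (paramsOf d L mT k hL))) (ν : Fin (d + 1))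
      (g : Tor (fine (L ^ k) (MP (paramsOf d L mT k hL))) × Fin (d + 1) → ℝ) (g' : Tor (fine (L ^ r * L ^ k) (MP (paramsOf d L mT k hL))) × Fin (d + 1) → ℝ)
      (_hg1 : ∀ b, |g b| ≤ 1) (_hg : ∀ b, g b ≠ 0 → b ∈ cubeW (L ^ k) c (L ^ s) ∧ (b.1 - unitVec (fine (L ^ k) (MP (paramsOf d L mT k hL))) ν, b.2) ∈ cubeW (L ^ k) c (L ^ s))
      (_hg1' : ∀ b, |g' b| ≤ 1)
      (_hg' : ∀ b, g' b ≠ 0 → b ∈ cubeW (L ^ r * L ^ k) c (L ^ s) ∧ (b.1 - unitVec (fine (L ^ r * L ^ k) (MP (paramsOf d L mT k hL))) ν, b.2) ∈ cubeW (L ^ r * L ^ k) c (L ^ s)),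
      HasMaj (BlockNorm.ofBlocks (unitTorusGeo L k (MP (paramsOf d L mT k hL)))
          (fun i : Tor (fine (L ^ k) (MP (paramsOf d L mT k hL))) × Fin (d + 1) => blockOf (L ^ k) (MP (paramsOf d L mT k hL)) i.1))
        (BlockNorm.ofBlocks (unitTorusGeo L k (MP (paramsOf d L mT k hL)))
          (fun i : Tor (fine (L ^ k) (MP (paramsOf d L mT k hL))) × Fin (d + 1) => blockOf (L ^ k) (MP (paramsOf d L mT k hL)) i.1))
        (mulOp (chiCube (MP (paramsOf d L mT k hL)) (L ^ k) c (L ^ s)) ∘ₗ liftCubeG (L ^ k) (MP_dvd_MP hL hs k) c (L ^ s) a ∘ₗ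
          symbOp (MP (paramsOf d L mT k hL)) (L ^ k) (sD (MP (paramsOf d L mT k hL)) (L ^ k) ν ((L ^ k : ℕ) : ℝ)) ∘ₗ mulOp g)
        (fun y y' => ind ((cubeBlocks (MP (paramsOf d L mT k hL)) c (L ^ s) : Finset _) : Set _) y *
          ind ((cubeBlocks (MP (paramsOf d L mT k hL)) c (L ^ s) : Finset _) : Set _) y' * (2 * (β * Real.exp δ) * Real.exp (-(δ * tdistT (MP (paramsOf d L mT k hL)) y y')))) ∧
      HasMaj (BlockNorm.ofBlocks (unitTorusGeo L k (MP (paramsOf d L mT k hL)))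
          (fun i : Tor (fine (L ^ r * L ^ k) (MP (paramsOf d L mT k hL))) × Fin (d + 1) => blockOf (L ^ r * L ^ k) (MP (paramsOf d L mT k hL)) i.1))
        (BlockNorm.ofBlocks (unitTorusGeo L k (MP (paramsOf d L mT k hL)))
          (fun i : Tor (fine (L ^ r * L ^ k) (MP (paramsOf d L mT k hL))) × Fin (d + 1) => blockOf (L ^ r * L ^ k) (MP (paramsOf d L mT k hL)) i.1))
        (mulOp (chiCube (MP (paramsOf d L mT k hL)) (L ^ r * L ^ k) c (L ^ s)) ∘ₗ liftCubeG (L ^ r * L ^ k) (MP_dvd_MP hL hs k) c (L ^ s) a ∘ₗ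
          symbOp (MP (paramsOf d L mT k hL)) (L ^ r * L ^ k) (sD (MP (paramsOf d L mT k hL)) (L ^ r * L ^ k) ν ((L ^ r * L ^ k : ℕ) : ℝ)) ∘ₗ mulOp g')
        (fun y y' => ind ((cubeBlocks (MP (paramsOf d L mT k hL)) c (L ^ s) : Finset _) : Set _) y *
          ind ((cubeBlocks (MP (paramsOf d L mT k hL)) c (L ^ s) : Finset _) : Set _) y' * (2 * (β * Real.exp δ) * Real.exp (-(δ * tdistT (MP (paramsOf d L mT k hL)) y y')))) := by
  obtain ⟨δ, β, hδ, hβ, H⟩ := hasMaj_transplant_gDivAdj_pair (d := d) hL ha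
  refine ⟨δ, β, hδ, hβ, fun s mT k r hs hk c ν g g' hg1 hg hg1' hg' => ⟨?_, ?_⟩⟩
  · have hM2 : ∀ μ, MP (paramsOf d L s k hL) μ = 2 * L ^ s := fun μ => rfl
    have hn : 1 ≤ L ^ k := Nat.one_le_pow _ _ (Nat.pos_of_ne_zero (NeZero.ne L))
    have e := chiCube_liftCubeG_comp_sD_mulOp (L ^ k) (MP_dvd_MP hL hs k) c (L ^ s) hM2 hn ha ν hg
    -- the transplant row without indicators, the shifted multiplier, the source shift, the sign
    have h0 := ((H s mT k r hs hk c ν).1).mono fun y y' =>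
      mul_le_of_le_one_left (mul_nonneg hβ.le (Real.exp_nonneg _)) (mul_le_one₀ (ind_le_one _ _) (ind_nonneg _ _) (ind_le_one _ _))
    have h1 := (ShiftSpecies.hasMaj_comp_mulOp_left (g := unitTorusGeo L k (MP (paramsOf d L mT k hL))) _
      (c' := fun b : Tor (fine (L ^ k) (MP (paramsOf d L mT k hL))) × Fin (d + 1) => g (b.1 + unitVec (fine (L ^ k) (MP (paramsOf d L mT k hL))) ν, b.2)) (α := 1)
      (fun _ _ => mul_nonneg hβ.le (Real.exp_nonneg _)) zero_le_one (fun b => hg1 _) h0).mono fun y y' => le_of_eq (one_mul _)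
    have h2 := (hasMaj_comp_fshift hβ.le hδ.le ν h1).neg
    have h3 := h2.congr fun f => (LinearMap.congr_fun e f).symm
    exact ((hasMaj_chiCube_comp_mulOp_of (Z := liftCubeG (L ^ k) (MP_dvd_MP hL hs k) c (L ^ s) a ∘ₗ
      symbOp (MP (paramsOf d L mT k hL)) (L ^ k) (sD (MP (paramsOf d L mT k hL)) (L ^ k) ν ((L ^ k : ℕ) : ℝ))) (fun b hb => (hg b hb).1) (by positivity)
      (h3.congr fun f => rfl)).congr fun f => rfl)
  · have hM2 : ∀ μ, MP (paramsOf d L s k hL) μ = 2 * L ^ s := fun μ => rfl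
    have hn' : 1 ≤ L ^ r * L ^ k := Nat.one_le_iff_ne_zero.mpr (Nat.mul_ne_zero (pow_ne_zero r (NeZero.ne L)) (pow_ne_zero k (NeZero.ne L)))
    have e := chiCube_liftCubeG_comp_sD_mulOp (L ^ r * L ^ k) (MP_dvd_MP hL hs k) c (L ^ s) hM2 hn' ha ν hg'
    have h0 := ((H s mT k r hs hk c ν).2).mono fun y y' =>
      mul_le_of_le_one_left (mul_nonneg hβ.le (Real.exp_nonneg _)) (mul_le_one₀ (ind_le_one _ _) (ind_nonneg _ _) (ind_le_one _ _))
    have h1 := (ShiftSpecies.hasMaj_comp_mulOp_left (g := unitTorusGeo L k (MP (paramsOf d L mT k hL))) _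
      (c' := fun b : Tor (fine (L ^ r * L ^ k) (MP (paramsOf d L mT k hL))) × Fin (d + 1) => g' (b.1 + unitVec (fine (L ^ r * L ^ k) (MP (paramsOf d L mT k hL))) ν, b.2)) (α := 1)
      (fun _ _ => mul_nonneg hβ.le (Real.exp_nonneg _)) zero_le_one (fun b => hg1' _) h0).mono fun y y' => le_of_eq (one_mul _)
    have h2 := (hasMaj_comp_fshift hβ.le hδ.le ν h1).neg
    have h3 := h2.congr fun f => (LinearMap.congr_fun e f).symm
    exact ((hasMaj_chiCube_comp_mulOp_of (Z := liftCubeG (L ^ r * L ^ k) (MP_dvd_MP hL hs k) c (L ^ s) a ∘ₗ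
      symbOp (MP (paramsOf d L mT k hL)) (L ^ r * L ^ k) (sD (MP (paramsOf d L mT k hL)) (L ^ r * L ^ k) ν ((L ^ r * L ^ k : ℕ) : ℝ))) (fun b hb => (hg' b hb).1)
      (by positivity) (h3.congr fun f => rfl)).congr fun f => rfl)

end Rows

end Summit.QuantumFields.YangMills.BalabanUVNodes.N15.TwoGrid

end
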